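import Summits.HodgeConjecture.CorCM.GaloisDicyclicNondegenerate
import HarnessLib

/-!
# The imprimitive CM types of a dicyclic Galois CM field are exactly the `C_q`-invariant ones

COR-CM (cell `pub-hodgecm2`), binder seat b04 (gen 20), count-neutral claim DICYCLIC-TWO-SHEET, part XIII — the first
step of the ALL-TYPES programme for `Gal(K/ℚ) ≅ Dic_n`, `n = 2^k q` (`q` an odd prime): a CM type `Φ` of `K`, read as
`S ⊆ Dic_n`, is IMPRIMITIVE iff `a^{2^{k+1}} S = S`, i.e. iff `S` is a union of cosets of the unique subgroup
`C_q = ⟨a^{2^{k+1}}⟩` of odd prime order — so the imprimitive types are precisely the lifts of the CM types of the unique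
proper CM subfield `K₀ = K^{C_q}` (Galois, group `Dic_n / C_q ≅ Q_{2^{k+2}}`, all of whose types are nondegenerate by
part IV).  KERNEL ONLY: theorems; no definition, no named fact, no `sorry`.  `HC_CM` is neither used nor claimed.

* §1 (any finite Galois group, model `e : Gal(K/ℚ) ≃* G₀`) `exists_leftStabiliser_of_not_isPrimitive`,
  `not_isPrimitive_iff_exists_leftStabiliser` — Shimura's criterion (§8.2 Prop. 26) read on the model: `Φ` is
  imprimitive iff its set `S` has a left stabiliser `v ≠ 1` (the converse of gen 16's `not_isPrimitive_of_leftStabiliser`).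
* §2 `exists_mul_eq_two_pow_of_forall_ne` — in `ℤ/2n`, `n = 2^k q`: a non-zero `j` no multiple of which is `n` has
  `2^{k+1}` among its multiples (Bézout; the subgroup generated by `j` has odd order, hence is `C_q`).
* §3 `leftStabiliser_pow_of_leftStabiliser` — in `Dic_n` a left stabiliser `v ≠ 1` of a CM set forces the left
  stabiliser `a^{2^{k+1}}` (elements outside `⟨a⟩` square to `c`; inside, §2).
* §4 **`not_isPrimitive_iff_dicyclic`** — `Φ` imprimitive ⟺ `a^{2^{k+1}} S = S`; with part IV: `Φ` is nondegenerate
  ⟺ primitive ⟺ `a^{2^{k+1}} S ≠ S` (`isNondegenerate_iff_isPrimitive_dicyclic`).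

## References

* [Shimura1998] G. Shimura, *Abelian Varieties with Complex Multiplication and Modular Functions*, §8.2 Prop. 26.
* [Kubota1965] T. Kubota, Trans. AMS 118 (1965), §2 (nondegenerate ⟹ primitive).
-/

noncomputable section

open NumberField
open scoped BigOperators

namespace Summit.HodgeConjecture.CorCM

open Literature.NumberTheory.ComplexMultiplication
open Literature.AlgebraicGeometry.Motives (CMType)
open Literature.AlgebraicGeometry.Pohlmann1968

/-! ## §1 Imprimitive ⟺ a non-trivial left stabiliser (any model) -/

namespace GaloisRank

variable {K : Type} [Field K] [NumberField K]
variable {G₀ : Type*} [Group G₀]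

/-- **An imprimitive type has a left stabiliser `v ≠ 1` on every model** (`K/ℚ` normal): two embeddings
`σ_{g₁} ≠ σ_{g₂}` with the same translate pattern give `v = e(g₂ g₁⁻¹)`. [cite: Shimura1998, §8.2 Prop. 26] -/
theorem exists_leftStabiliser_of_not_isPrimitive [Normal ℚ K] (e : (K ≃ₐ[ℚ] K) ≃* G₀) (Φ : CMType K)
    (φ₀ : K →+* ℂ) (S : Finset G₀) (hS : ∀ y : G₀, y ∈ S ↔ embOf φ₀ (e.symm y) ∈ Φ.1)
    (h : ¬ IsPrimitive (ℂ ≃+* ℂ) Φ.1 φ₀) : ∃ v : G₀, v ≠ 1 ∧ ∀ w : G₀, w ∈ S ↔ v * w ∈ S := by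
  haveI := isPretransitive_ringEquiv_complex (K := K)
  rw [isPrimitive_iff_forall_eq] at h
  push Not at h
  obtain ⟨x, y, hxy, hne⟩ := h
  obtain ⟨g₁, rfl⟩ := (embOf_bijective φ₀).2 x
  obtain ⟨g₂, rfl⟩ := (embOf_bijective φ₀).2 y
  refine ⟨e (g₂ * g₁⁻¹), fun h1 => hne ?_, fun w => ?_⟩
  · have : g₂ * g₁⁻¹ = 1 := e.injective (by rw [h1, map_one])
    rw [mul_inv_eq_one.1 this]
  · -- `w = e (g₁ δ)` with `δ = g₁⁻¹ e⁻¹(w)`; use `τ` with `τ ∘ φ₀ = φ₀ ∘ δ⁻¹`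
    obtain ⟨τ, hτ⟩ := exists_ringEquiv_comp_eq_algEquiv φ₀ (g₁⁻¹ * e.symm w)⁻¹
    have h1 : τ • embOf φ₀ g₁ = embOf φ₀ (e.symm w) := by
      rw [smul_embOf_of_comp φ₀ hτ, inv_inv, mul_inv_cancel_left]
    have h2 : τ • embOf φ₀ g₂ = embOf φ₀ (e.symm (e (g₂ * g₁⁻¹) * w)) := by
      rw [smul_embOf_of_comp φ₀ hτ, inv_inv, map_mul, e.symm_apply_apply, ← mul_assoc]
    rw [hS, hS, ← h1, ← h2]
    exact hxy τ

/-- **Imprimitive ⟺ a non-trivial left stabiliser** of the set read on the model. [cite: Shimura1998, §8.2 Prop. 26] -/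
theorem not_isPrimitive_iff_exists_leftStabiliser [Normal ℚ K] (e : (K ≃ₐ[ℚ] K) ≃* G₀) (Φ : CMType K)
    (φ₀ : K →+* ℂ) (S : Finset G₀) (hS : ∀ y : G₀, y ∈ S ↔ embOf φ₀ (e.symm y) ∈ Φ.1) :
    ¬ IsPrimitive (ℂ ≃+* ℂ) Φ.1 φ₀ ↔ ∃ v : G₀, v ≠ 1 ∧ ∀ w : G₀, w ∈ S ↔ v * w ∈ S :=
  ⟨exists_leftStabiliser_of_not_isPrimitive e Φ φ₀ S hS,
    fun ⟨_, hv1, hv⟩ => not_isPrimitive_of_leftStabiliser e Φ φ₀ S hS hv1 hv⟩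

end GaloisRank

/-! ## §2 Multiples in `ℤ/2n`, `n = 2^k q` -/

namespace GaloisDicyclic

/-- **In `ℤ/2n` (`n = 2^k q`, `q` an odd prime) a non-zero `j` none of whose multiples is `n` has `2^{k+1}` as a
multiple**: with `g = gcd(j, 2n)` a multiple of `j` equals `g` (Bézout); `g ∣ n` is excluded, so `2n/g` is odd, hence
`2n/g ∈ {1, q}`, and `2n/g = 1` would force `j = 0`. [folklore] -/
theorem exists_mul_eq_two_pow_of_forall_ne {n k q : ℕ} [NeZero n] (hn : n = 2 ^ k * q) (hq : q.Prime)
    {j : ZMod (2 * n)} (hj : j ≠ 0) (hjn : ∀ m : ℕ, (m : ZMod (2 * n)) * j ≠ n) :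
    ∃ m : ℕ, (m : ZMod (2 * n)) * j = ((2 ^ (k + 1) : ℕ) : ZMod (2 * n)) := by
  have h2n : 0 < 2 * n := by have := NeZero.pos n; omega
  set J : ℕ := j.val with hJ
  have hJlt : J < 2 * n := ZMod.val_lt j
  have hJ0 : J ≠ 0 := fun h => hj ((ZMod.val_eq_zero j).1 h)
  have hjJ : (J : ZMod (2 * n)) = j := ZMod.natCast_zmod_val j
  set g : ℕ := Nat.gcd J (2 * n) with hg
  have hgpos : 0 < g := Nat.gcd_pos_of_pos_left _ (Nat.pos_of_ne_zero hJ0)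
  have hgdvd : g ∣ 2 * n := Nat.gcd_dvd_right _ _
  have hgJ : g ∣ J := Nat.gcd_dvd_left _ _
  -- Bézout: some multiple of `j` is `g`
  have hglt : g < 2 * n := lt_of_le_of_lt (Nat.le_of_dvd (Nat.pos_of_ne_zero hJ0) hgJ) hJlt
  obtain ⟨m, -, hm⟩ := Nat.exists_mul_mod_eq_gcd (k := 2 * n) (n := J) hglt
  have hmj : (m : ZMod (2 * n)) * j = (g : ZMod (2 * n)) := by
    rw [← hjJ, ← Nat.cast_mul, mul_comm m J, ← ZMod.natCast_mod (J * m) (2 * n), hm, hg]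
  -- `g ∤ n`
  have hgn : ¬ g ∣ n := by
    rintro ⟨t, ht⟩
    apply hjn (t * m)
    rw [Nat.cast_mul, mul_assoc, hmj, ← Nat.cast_mul, mul_comm t g, ← ht]
  -- so `2n = g t'` with `t'` odd, `t' ∣ q`
  obtain ⟨t', ht'⟩ := hgdvd
  have ht'odd : ¬ 2 ∣ t' := by
    rintro ⟨u, rfl⟩
    apply hgn
    exact ⟨u, by linarith⟩
  have ht'q : t' ∣ q := by
    have hcop : Nat.Coprime t' (2 ^ (k + 1)) :=
      (Nat.Coprime.pow_right _ ((Nat.Prime.coprime_iff_not_dvd Nat.prime_two).2 ht'odd).symm)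
    have : t' ∣ 2 ^ (k + 1) * q := ⟨g, by rw [← show 2 * n = 2 ^ (k + 1) * q by rw [hn]; ring, ht', mul_comm]⟩
    exact hcop.dvd_of_dvd_mul_left this
  rcases (Nat.dvd_prime hq).1 ht'q with ht1 | htq
  · -- `t' = 1`: `g = 2n > J`, impossible
    exfalso
    rw [ht1, mul_one] at ht'
    rw [← ht'] at hglt
    exact lt_irrefl _ hglt
  · -- `t' = q`: `g = 2^{k+1}`
    rw [htq] at ht'
    have hg2 : g = 2 ^ (k + 1) := by
      have h1 : g * q = 2 ^ (k + 1) * q := by rw [← ht', hn]; ring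
      exact Nat.eq_of_mul_eq_mul_right hq.pos h1
    exact ⟨m, by rw [hmj, hg2]⟩

/-! ## §3 Left stabilisers in `Dic_n` -/

variable {n : ℕ} [NeZero n]

/-- **A left stabiliser `v ≠ 1` of a CM set of `Dic_n` (`n = 2^k q`) forces the left stabiliser `a^{2^{k+1}}`.**
Elements outside `⟨a⟩` square to `c = a n`, which moves the set; so `v = a j`, the multiples of `j` avoid `n`, and
§2 applies. [folklore] -/
theorem leftStabiliser_pow_of_leftStabiliser {k q : ℕ} (hn : n = 2 ^ k * q) (hq : q.Prime)
    (S : Finset (QuaternionGroup n)) (hScm : ∀ y : QuaternionGroup n, QuaternionGroup.a n * y ∈ S ↔ y ∉ S)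
    {v : QuaternionGroup n} (hv1 : v ≠ 1) (hv : ∀ w : QuaternionGroup n, w ∈ S ↔ v * w ∈ S) :
    ∀ w : QuaternionGroup n, w ∈ S ↔ QuaternionGroup.a ((2 ^ (k + 1) : ℕ) : ZMod (2 * n)) * w ∈ S := by
  -- the stabiliser is closed under products and does not contain `c = a n`
  have hS0 : S.Nonempty := by
    by_contra h
    rw [Finset.not_nonempty_iff_eq_empty] at h
    have := (hScm 1).2 (by rw [h]; exact Finset.notMem_empty _)
    rw [h] at this
    exact Finset.notMem_empty _ this
  obtain ⟨w₀, hw₀⟩ := hS0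
  have hpow : ∀ (u : QuaternionGroup n), (∀ w, w ∈ S ↔ u * w ∈ S) → ∀ m : ℕ, ∀ w, w ∈ S ↔ u ^ m * w ∈ S := by
    intro u hu m
    induction m with
    | zero => intro w; rw [pow_zero, one_mul]
    | succ m ih => intro w; rw [pow_succ, mul_assoc, ← ih, ← hu]
  have hnotc : ¬ ∀ w, w ∈ S ↔ QuaternionGroup.a n * w ∈ S := fun h =>
    ((hScm w₀).1 ((h w₀).1 hw₀)) hw₀
  rcases v with j | j
  · -- `v = a j`
    have hj : j ≠ 0 := fun h => hv1 (by rw [h, QuaternionGroup.one_def])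
    have hapow : ∀ m : ℕ, (QuaternionGroup.a j : QuaternionGroup n) ^ m = QuaternionGroup.a ((m : ZMod (2 * n)) * j) := by
      intro m
      induction m with
      | zero => rw [pow_zero, Nat.cast_zero, zero_mul, QuaternionGroup.one_def]
      | succ m ih => rw [pow_succ, ih, QuaternionGroup.a_mul_a, Nat.cast_succ, add_mul, one_mul]
    have hjn : ∀ m : ℕ, (m : ZMod (2 * n)) * j ≠ n := by
      intro m hm
      apply hnotc
      intro w
      rw [hpow _ hv m w, hapow, hm]
    obtain ⟨m, hm⟩ := exists_mul_eq_two_pow_of_forall_ne hn hq hj hjn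
    intro w
    rw [hpow _ hv m w, hapow, hm]
  · -- `v = xa j`: `v² = a n` would stabilise `S`
    exfalso
    apply hnotc
    intro w
    rw [hpow _ hv 2 w, QuaternionGroup.xa_sq]

/-! ## §4 Field level -/

variable {K : Type} [Field K] [NumberField K] [IsCMField K] [IsGalois ℚ K]

/-- **THEOREM.  `Gal(K/ℚ) ≅ Dic_n`, `n = 2^k q`: a CM type is IMPRIMITIVE iff its set `S` is stable under the left
translation by `a^{2^{k+1}}`** (i.e. is a union of cosets of the unique subgroup `C_q` of odd prime order — a lift from
the unique proper CM subfield `K^{C_q}`). [cite: Shimura1998, §8.2 Prop. 26] -/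
theorem not_isPrimitive_iff_dicyclic {k q : ℕ} (hn : n = 2 ^ k * q) (hq : q.Prime)
    (e : (K ≃ₐ[ℚ] K) ≃* QuaternionGroup n) (Φ : CMType K) (φ₀ : K →+* ℂ) (S : Finset (QuaternionGroup n))
    (hS : ∀ y, y ∈ S ↔ embOf φ₀ (e.symm y) ∈ Φ.1) :
    ¬ IsPrimitive (ℂ ≃+* ℂ) Φ.1 φ₀ ↔
      ∀ w : QuaternionGroup n, w ∈ S ↔ QuaternionGroup.a ((2 ^ (k + 1) : ℕ) : ZMod (2 * n)) * w ∈ S := by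
  have hc := map_complexConj_eq_a e
  have hScm := GaloisRank.model_mul_mem_iff e hc Φ φ₀ S hS
  constructor
  · intro h
    obtain ⟨v, hv1, hv⟩ := GaloisRank.exists_leftStabiliser_of_not_isPrimitive e Φ φ₀ S hS h
    exact leftStabiliser_pow_of_leftStabiliser hn hq S hScm hv1 hv
  · intro h
    have hv1 : (QuaternionGroup.a ((2 ^ (k + 1) : ℕ) : ZMod (2 * n)) : QuaternionGroup n) ≠ 1 := by
      rw [QuaternionGroup.one_def, Ne, QuaternionGroup.a.injEq, ZMod.natCast_eq_zero_iff]
      intro hd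
      have h1 := Nat.le_of_dvd (by positivity) hd
      have h2 : 2 * n = 2 ^ (k + 1) * q := by rw [hn]; ring
      have h3 := hq.two_le
      have h4 : 0 < 2 ^ (k + 1) := by positivity
      nlinarith
    exact GaloisRank.not_isPrimitive_of_leftStabiliser e Φ φ₀ S hS hv1 h

/-- **Hence for `Gal(K/ℚ) ≅ Dic_n`, `n = 2^k q`: nondegenerate ⟺ primitive ⟺ `a^{2^{k+1}} S ≠ S`** (Kubota one way,
part IV the other). [cite: Kubota1965, §2 (p. 115)] [cite: Shimura1998, §8.2 Prop. 26] -/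
theorem isNondegenerate_iff_isPrimitive_dicyclic {k q : ℕ} (hn : n = 2 ^ k * q) (hq : q.Prime) (hq2 : q ≠ 2)
    (e : (K ≃ₐ[ℚ] K) ≃* QuaternionGroup n) (Φ : CMType K) (φ₀ : K →+* ℂ) :
    IsNondegenerate Φ ↔ IsPrimitive (ℂ ≃+* ℂ) Φ.1 φ₀ :=
  ⟨fun h => h.isPrimitive φ₀, isNondegenerate_of_isPrimitive_dicyclic hn hq hq2 e φ₀⟩

end GaloisDicyclic

end Summit.HodgeConjecture.CorCM

end
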